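import Summits.QuantumFields.YangMills.Theorems.SoloBlindRPCovariance
import Literature.MathematicalPhysics.QuantumFieldTheory.ConstructiveQFTWave0OddRPProofs
import HarnessLib

/-!
# Reflection positivity on odd tori (solo-QuantumFields-blind, rung D8, part 1)

## Positivity of the time autocorrelation of a time-zero spatial observable at every separation

The statement `Summit.QuantumFields.YangMills` measures the lattice mass gap in the Wilson state of
the ODD torus `(ℤ/(2S+1))⁴`.  The rungs D7/D7⁺ of this line (`SoloBlindTwoPointRP`,
`SoloBlindRPCovariance`, …) established the Osterwalder–Seiler positivity structure of time
two-point functions on EVEN tori.  This file transfers it to odd side length, from the tree's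
odd-torus theorem `wilsonExpectation_oddReflectionPositive` (reflection `θ t = 1 - t` of `(ℤ/L)^d`,
`L` odd, fixing the link hyperplane `0 | 1` and the site hyperplane `t = (L+1)/2`):

* `wilsonExpectation_odd_timeReflect_mul_ge` — the covariance inequality `⟨ΘF⟩⟨F⟩ ≤ ⟨ΘF · F⟩` for
  every bounded measurable real observable of the closed positive half (links of
  `WilsonOddRP.oPosEdges ∪ WilsonOddRP.oSharedEdges`), `β ≥ 0`, `L ≥ 3` odd;
* `wilsonExpectation_sq_le_timeZero_twoPoint` — for a TIME-ZERO SPATIAL observable `F` (a function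
  of the spatial links of the slice `t = 0`: spatial plaquettes and Wilson loops, smeared glueball
  operators) and EVERY time separation `s ∈ ℤ/L`:  `⟨F⟩² ≤ ⟨F · F(· + s e₀)⟩`, i.e. the connected
  time autocorrelation of `F` is non-negative at all separations
  (`wilsonExpectation_timeZero_connected_nonneg`).  On an odd torus ONE reflection suffices for
  all `s`: the mirror pairs `(t, 1 - t)`, `1 ≤ t ≤ L/2 + 1`, realise the separations `2t - 1`, and
  these together with their negatives exhaust `ℤ/L` because `2` is invertible modulo odd `L`
  (`exists_oddSlice`); translation invariance and the evenness of an autocorrelation in `s` do the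
  rest.

The summit-native corollary — `0 ≤ latticeConnectedCorr ρ β (2S+1) A.F A.F n` for every
`A : YMSpecies G` supported on time-zero spatial links — is in the sequel
`SoloBlindOddTorusCorrelator`.

References: K. Osterwalder, E. Seiler, Ann. Phys. 110 (1978) 440, §2; E. Seiler, LNP 159 (1982)
Ch. 2; J. Fröhlich, R. Israel, E. Lieb, B. Simon, CMP 62 (1978) 1, Thm. 2.1 (site hyperplanes);
J. Glimm, A. Jaffe, *Quantum Physics* (1987) §6.1. [folklore consequences of OS positivity; the
typed odd-torus statements are this unit's]
-/

open MeasureTheory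
open Literature.MathematicalPhysics.QuantumFieldTheory

noncomputable section

namespace Summit.QuantumFields.YangMills.Theorems.SoloBlind

/-! ### Odd time arithmetic -/

section Arith

variable {L : ℕ}

/-- On an odd torus every time separation `s` is `±(2t - 1)` for a slice `t` of the closed
positive half `1 ≤ t ≤ L/2 + 1` (because `2 (L/2 + 1) = L + 1 ≡ 1`). [folklore] -/
theorem exists_oddSlice (hL : Odd L) (hL3 : 3 ≤ L) (s : ZMod L) :
    ∃ t : ZMod L, 1 ≤ t.val ∧ t.val ≤ L / 2 + 1 ∧ (2 * t - 1 = s ∨ 2 * t - 1 = -s) := by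
  haveI : NeZero L := ⟨by omega⟩
  obtain ⟨m, hm⟩ := hL
  have hdiv : L / 2 = m := by omega
  set c : ZMod L := ((m + 1 : ℕ) : ZMod L) with hc
  have h2 : (2 : ZMod L) * c = 1 := by
    rw [hc, show (2 : ZMod L) = ((2 : ℕ) : ZMod L) by norm_cast, ← Nat.cast_mul,
      show 2 * (m + 1) = L + 1 by omega, Nat.cast_add, ZMod.natCast_self, zero_add, Nat.cast_one]
  set t₀ : ZMod L := (s + 1) * c with ht₀
  have hkey : 2 * t₀ - 1 = s := by
    rw [ht₀]
    linear_combination (s + 1) * h2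
  have hv : t₀ = ((t₀.val : ℕ) : ZMod L) := (ZMod.natCast_zmod_val t₀).symm
  have hvlt : t₀.val < L := ZMod.val_lt t₀
  by_cases hA : 1 ≤ t₀.val ∧ t₀.val ≤ L / 2 + 1
  · exact ⟨t₀, hA.1, hA.2, Or.inl hkey⟩
  · -- use the mirror slice `1 - t₀`, which realises the separation `-s`
    have hval : 1 ≤ (1 - t₀ : ZMod L).val ∧ (1 - t₀ : ZMod L).val ≤ L / 2 + 1 := by
      rcases Nat.eq_zero_or_pos t₀.val with h0 | hpos
      · have ht : (1 : ZMod L) - t₀ = ((1 : ℕ) : ZMod L) := by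
          rw [hv, h0, Nat.cast_zero, sub_zero, Nat.cast_one]
        rw [ht, ZMod.val_natCast, Nat.mod_eq_of_lt (show 1 < L by omega)]
        omega
      · have ht : (1 : ZMod L) - t₀ = ((L + 1 - t₀.val : ℕ) : ZMod L) := by
          rw [Nat.cast_sub (show t₀.val ≤ L + 1 by omega), Nat.cast_add, ZMod.natCast_self,
            zero_add, Nat.cast_one, ← hv]
        rw [ht, ZMod.val_natCast, Nat.mod_eq_of_lt (show L + 1 - t₀.val < L by omega)]
        omega
    exact ⟨1 - t₀, hval.1, hval.2, Or.inr (by linear_combination (-1 : ZMod L) * hkey)⟩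

end Arith

/-! ### Reflection positivity on the odd torus as a covariance inequality -/

section OddCovariance

variable {d L N : ℕ} [NeZero d] [NeZero L] {G : Type*} [Group G] [TopologicalSpace G]
  [IsTopologicalGroup G] [CompactSpace G] [MeasurableSpace G] [BorelSpace G]
  (ρ : G →* Matrix (Fin N) (Fin N) ℂ)

/-- Odd-torus reflection positivity for the centred observable: `0 ≤ ⟨(ΘF − c)(F − c)⟩_{Λ,β}` for
every bounded measurable real observable `F` of the closed positive half (links of `P ∪ M`),
every constant `c`, `β ≥ 0`, `L ≥ 3` odd. [folklore] -/
theorem wilsonExpectation_odd_centred_timeReflect_mul_nonneg (hL : Odd L) (hL3 : 3 ≤ L)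
    (hρ : Continuous ρ) {β : ℝ} (hβ : 0 ≤ β) {F : GaugeConfig d L G → ℝ} (hFm : Measurable F)
    (hFb : ∃ C : ℝ, ∀ U, |F U| ≤ C)
    (hFdep : DependsOn F
      ((WilsonOddRP.oPosEdges ∪ WilsonOddRP.oSharedEdges : Finset (Edge d L)) : Set (Edge d L)))
    (c : ℝ) :
    0 ≤ wilsonExpectation ρ β fun U => (F U.timeReflect - c) * (F U - c) := by
  obtain ⟨C, hC⟩ := hFb
  set Fc : GaugeConfig d L G → ℂ := fun U => ((F U - c : ℝ) : ℂ) with hFc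
  have hFcm : Measurable Fc := Complex.measurable_ofReal.comp (hFm.sub_const c)
  have hFcb : ∃ C' : ℝ, ∀ U, ‖Fc U‖ ≤ C' := by
    refine ⟨C + |c|, fun U => ?_⟩
    rw [hFc]
    simp only [Complex.norm_real, Real.norm_eq_abs]
    calc |F U - c| ≤ |F U| + |c| := abs_sub _ _
      _ ≤ C + |c| := by gcongr; exact hC U
  have hFcdep : DependsOn Fc
      ((WilsonOddRP.oPosEdges ∪ WilsonOddRP.oSharedEdges : Finset (Edge d L)) : Set (Edge d L)) :=
    fun U V hUV => by simp only [hFc, hFdep hUV]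
  have hRP := wilsonExpectation_oddReflectionPositive (d := d) (L := L) ρ hL hL3 hρ hβ Fc hFcm hFcb
    hFcdep
  have hint : (fun U : GaugeConfig d L G => (starRingEnd ℂ) (Fc U.timeReflect) * Fc U) =
      fun U => (((F U.timeReflect - c) * (F U - c) : ℝ) : ℂ) := by
    funext U
    rw [hFc]
    simp only [Complex.conj_ofReal, Complex.ofReal_mul]
  rw [hint] at hRP
  unfold wilsonExpectation at hRP ⊢
  rw [integral_complex_ofReal] at hRP
  exact Complex.zero_le_real.mp hRP

/-- **Reflection positivity on the odd torus as a covariance inequality.**  For `β ≥ 0`, `L ≥ 3`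
odd and every bounded measurable real observable `F` of the closed positive half:
`⟨ΘF⟩_{Λ,β} · ⟨F⟩_{Λ,β} ≤ ⟨ΘF · F⟩_{Λ,β}`. [folklore] -/
theorem wilsonExpectation_odd_timeReflect_mul_ge (hL : Odd L) (hL3 : 3 ≤ L) (hρ : Continuous ρ)
    {β : ℝ} (hβ : 0 ≤ β) {F : GaugeConfig d L G → ℝ} (hFm : Measurable F)
    (hFb : ∃ C : ℝ, ∀ U, |F U| ≤ C)
    (hFdep : DependsOn F
      ((WilsonOddRP.oPosEdges ∪ WilsonOddRP.oSharedEdges : Finset (Edge d L)) : Set (Edge d L))) :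
    wilsonExpectation ρ β (fun U => F U.timeReflect) * wilsonExpectation ρ β F ≤
      wilsonExpectation ρ β fun U => F U.timeReflect * F U := by
  haveI := isProbabilityMeasure_wilsonMeasure (d := d) (L := L) (G := G) ρ hρ β
  obtain ⟨C, hC⟩ := hFb
  set c := wilsonExpectation ρ β F with hc
  have h0 := wilsonExpectation_odd_centred_timeReflect_mul_nonneg ρ hL hL3 hρ hβ hFm ⟨C, hC⟩ hFdep c
  set A : GaugeConfig d L G → ℝ := fun U => F U.timeReflect with hA
  have hAm : Measurable A := hFm.comp WilsonRP.measurable_timeReflect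
  have hAi : Integrable A (wilsonMeasure ρ β) :=
    Integrable.of_bound hAm.aestronglyMeasurable C
      (ae_of_all _ fun U => by rw [Real.norm_eq_abs]; exact hC _)
  have hFi : Integrable F (wilsonMeasure ρ β) :=
    Integrable.of_bound hFm.aestronglyMeasurable C
      (ae_of_all _ fun U => by rw [Real.norm_eq_abs]; exact hC _)
  have hAFi : Integrable (fun U => A U * F U) (wilsonMeasure ρ β) := by
    refine Integrable.of_bound (hAm.mul hFm).aestronglyMeasurable (C * C) (ae_of_all _ fun U => ?_)
    rw [Real.norm_eq_abs, abs_mul]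
    exact mul_le_mul (hC _) (hC _) (abs_nonneg _) ((abs_nonneg _).trans (hC U))
  have hexp : (fun U => (A U - c) * (F U - c)) =
      fun U => A U * F U - c * A U - c * F U + c ^ 2 := by
    funext U; ring
  have hE : wilsonExpectation ρ β (fun U => (A U - c) * (F U - c)) =
      wilsonExpectation ρ β (fun U => A U * F U) - c * wilsonExpectation ρ β A
        - c * wilsonExpectation ρ β F + c ^ 2 := by
    have i2 : Integrable (fun U => A U * F U - c * A U) (wilsonMeasure ρ β) :=
      hAFi.sub (hAi.const_mul c)
    have i3 : Integrable (fun U => A U * F U - c * A U - c * F U) (wilsonMeasure ρ β) :=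
      i2.sub (hFi.const_mul c)
    unfold wilsonExpectation
    rw [hexp, integral_add i3 (integrable_const _), integral_sub i2 (hFi.const_mul c),
      integral_sub hAFi (hAi.const_mul c), integral_const_mul, integral_const_mul, integral_const]
    simp [Measure.real]
  have hEF : wilsonExpectation ρ β F = c := hc.symm
  rw [hE, hEF] at h0
  nlinarith [h0]

end OddCovariance

/-! ### Time-zero spatial observables: positivity of the time autocorrelation at ALL separations -/

section TimeZero

variable {d L N : ℕ} [NeZero d] [NeZero L] {G : Type*} [Group G] [TopologicalSpace G]
  [IsTopologicalGroup G] [CompactSpace G] [MeasurableSpace G] [BorelSpace G]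
  (ρ : G →* Matrix (Fin N) (Fin N) ℂ)

omit [NeZero L] [TopologicalSpace G] [IsTopologicalGroup G] [CompactSpace G] [BorelSpace G] in
/-- The time reflection `Θ` carries the time-`t` translate of a time-zero spatial observable to
its time-`(1 - t)` translate (spatial links are carried along without inversion). [folklore] -/
theorem timeZero_translate_timeReflect {F : GaugeConfig d L G → ℝ}
    (hF0 : DependsOn F {e : Edge d L | e.1 0 = 0 ∧ e.2 ≠ 0}) (t : ZMod L) (U : GaugeConfig d L G) :
    F (torusConfigShift (-(Pi.single (0 : Fin d) t : Site d L)) U.timeReflect) =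
      F (torusConfigShift (-(Pi.single (0 : Fin d) (1 - t) : Site d L)) U) := by
  apply hF0
  rintro e ⟨he0, he2⟩
  simp only [torusConfigShift_apply, GaugeConfig.timeReflect, he2, if_false]
  congr 2
  funext k
  by_cases hk : k = 0
  · subst hk
    simp [WilsonRP.timeReflect_apply_zero, he0]
  · simp [WilsonRP.timeReflect_apply_of_ne _ hk, hk]

omit [Group G] [TopologicalSpace G] [IsTopologicalGroup G] [CompactSpace G] [BorelSpace G] in
/-- The time-`t` translate of a time-zero spatial observable, `1 ≤ t ≤ L/2 + 1`, lives in the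
closed positive half of the odd torus (links of `P ∪ M`). [folklore] -/
theorem dependsOn_timeZero_translate {F : GaugeConfig d L G → ℝ}
    (hF0 : DependsOn F {e : Edge d L | e.1 0 = 0 ∧ e.2 ≠ 0}) {t : ZMod L} (ht1 : 1 ≤ t.val)
    (ht2 : t.val ≤ L / 2 + 1) :
    DependsOn (fun U => F (torusConfigShift (-(Pi.single (0 : Fin d) t : Site d L)) U))
      ((WilsonOddRP.oPosEdges ∪ WilsonOddRP.oSharedEdges : Finset (Edge d L)) :
        Set (Edge d L)) := by
  intro U V hUV
  apply hF0
  rintro e ⟨he0, he2⟩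
  simp only [torusConfigShift_apply]
  apply hUV
  have ht : (e.1 - -(Pi.single (0 : Fin d) t : Site d L) : Site d L) 0 = t := by simp [he0]
  simp only [Finset.coe_union, Set.mem_union, Finset.mem_coe, WilsonOddRP.mem_oPosEdges,
    WilsonOddRP.mem_oSharedEdges, WilsonOddRP.IsOPosEdge, WilsonOddRP.IsOSharedEdge, ht]
  rcases Nat.lt_or_ge t.val (L / 2 + 1) with h | h
  · exact Or.inl ⟨ht1, by omega⟩
  · exact Or.inr ⟨he2, by omega⟩

/-- Reflection positivity for the mirror pair `(t, 1 - t)` of translates of a time-zero spatial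
observable, moved by translation invariance to the pair `(0, 2t - 1)`:
`⟨F⟩² ≤ ⟨F · F(· + (2t-1) e₀)⟩` for `1 ≤ t ≤ L/2 + 1`, `L ≥ 3` odd, `β ≥ 0`. [folklore] -/
theorem wilsonExpectation_sq_le_timeZero_twoPoint_slice (hL : Odd L) (hL3 : 3 ≤ L)
    (hρ : Continuous ρ) {β : ℝ} (hβ : 0 ≤ β) {F : GaugeConfig d L G → ℝ} (hFm : Measurable F)
    (hFb : ∃ C : ℝ, ∀ U, |F U| ≤ C) (hF0 : DependsOn F {e : Edge d L | e.1 0 = 0 ∧ e.2 ≠ 0})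
    {t : ZMod L} (ht1 : 1 ≤ t.val) (ht2 : t.val ≤ L / 2 + 1) :
    (wilsonExpectation ρ β F) ^ 2 ≤
      wilsonExpectation ρ β fun U =>
        F U * F (torusConfigShift (-(Pi.single (0 : Fin d) (2 * t - 1) : Site d L)) U) := by
  obtain ⟨C, hC⟩ := hFb
  -- the translate `F_t` and reflection positivity for it
  set Ft : GaugeConfig d L G → ℝ :=
    fun U => F (torusConfigShift (-(Pi.single (0 : Fin d) t : Site d L)) U) with hFt
  have hFtm : Measurable Ft := hFm.comp (torusConfigShift _).measurable
  have hFtb : ∃ C : ℝ, ∀ U, |Ft U| ≤ C := ⟨C, fun U => hC _⟩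
  have hRP := wilsonExpectation_odd_timeReflect_mul_ge ρ hL hL3 hρ hβ hFtm hFtb
    (dependsOn_timeZero_translate hF0 ht1 ht2)
  -- `ΘF_t = F_{1-t}`
  have hΘ : (fun U => Ft U.timeReflect) =
      fun U => F (torusConfigShift (-(Pi.single (0 : Fin d) (1 - t) : Site d L)) U) := by
    funext U
    exact timeZero_translate_timeReflect hF0 t U
  -- one-point functions by translation invariance
  have h1 : wilsonExpectation ρ β Ft = wilsonExpectation ρ β F :=
    wilsonExpectation_comp_torusConfigShift ρ β (-(Pi.single (0 : Fin d) t : Site d L)) F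
  have h1' : wilsonExpectation ρ β (fun U => Ft U.timeReflect) = wilsonExpectation ρ β F := by
    rw [hΘ]
    exact wilsonExpectation_comp_torusConfigShift ρ β
      (-(Pi.single (0 : Fin d) (1 - t) : Site d L)) F
  -- two-point function by translation invariance: move the pair `(1 - t, t)` to `(0, 2t - 1)`
  have hcomp : ∀ (a b : Site d L) (V : GaugeConfig d L G),
      torusConfigShift a (torusConfigShift b V) = torusConfigShift (a + b) V := fun a b V => by
    funext e
    simp only [torusConfigShift_apply, sub_sub]
  have h2 : wilsonExpectation ρ β (fun U => Ft U.timeReflect * Ft U) =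
      wilsonExpectation ρ β fun U =>
        F U * F (torusConfigShift (-(Pi.single (0 : Fin d) (2 * t - 1) : Site d L)) U) := by
    rw [← wilsonExpectation_comp_torusConfigShift ρ β (-(Pi.single (0 : Fin d) (1 - t) : Site d L))
      (fun U => F U * F (torusConfigShift (-(Pi.single (0 : Fin d) (2 * t - 1) : Site d L)) U))]
    have hv : -(Pi.single (0 : Fin d) (2 * t - 1) : Site d L) +
        -(Pi.single (0 : Fin d) (1 - t) : Site d L) = -(Pi.single (0 : Fin d) t : Site d L) := by
      have ht : (2 * t - 1) + (1 - t) = t := by ring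
      rw [← neg_add, ← Pi.single_add, ht]
    congr 1
    funext U
    simp only [Function.comp_apply, hcomp, hv, hFt, timeZero_translate_timeReflect hF0 t U]
  rw [h1, h1', h2] at hRP
  nlinarith [hRP]

/-- The time autocorrelation of an observable is even in the separation (translation invariance).
[folklore] -/
theorem wilsonExpectation_twoPoint_neg (β : ℝ) (F : GaugeConfig d L G → ℝ) (s : ZMod L) :
    wilsonExpectation ρ β
        (fun U => F U * F (torusConfigShift (-(Pi.single (0 : Fin d) s : Site d L)) U)) =
      wilsonExpectation ρ β fun U =>
        F U * F (torusConfigShift (-(Pi.single (0 : Fin d) (-s) : Site d L)) U) := by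
  rw [← wilsonExpectation_comp_torusConfigShift ρ β (-(Pi.single (0 : Fin d) s : Site d L))
    (fun U => F U * F (torusConfigShift (-(Pi.single (0 : Fin d) (-s) : Site d L)) U))]
  have hv : -(Pi.single (0 : Fin d) (-s) : Site d L) + -(Pi.single (0 : Fin d) s : Site d L) = 0 :=
    by
    rw [Pi.single_neg, neg_neg, add_neg_cancel]
  have hcomp : ∀ V : GaugeConfig d L G,
      torusConfigShift (-(Pi.single (0 : Fin d) (-s) : Site d L))
          (torusConfigShift (-(Pi.single (0 : Fin d) s : Site d L)) V) = V := fun V => by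
    funext e
    simp only [torusConfigShift_apply, sub_sub, hv, sub_zero, Prod.mk.eta]
  congr 1
  funext U
  simp only [Function.comp_apply, hcomp]
  ring

/-- **Positivity of the time autocorrelation of a time-zero spatial observable at every
separation** (odd torus `L ≥ 3`, `β ≥ 0`): `⟨F⟩² ≤ ⟨F · F(· + s e₀)⟩` for all `s ∈ ℤ/L`.  One
reflection gives the separations `2t - 1`, `1 ≤ t ≤ L/2 + 1`; these and their negatives exhaust
`ℤ/L` (`exists_oddSlice`), and the autocorrelation is even in `s`. [folklore] -/
theorem wilsonExpectation_sq_le_timeZero_twoPoint (hL : Odd L) (hL3 : 3 ≤ L) (hρ : Continuous ρ)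
    {β : ℝ} (hβ : 0 ≤ β) {F : GaugeConfig d L G → ℝ} (hFm : Measurable F)
    (hFb : ∃ C : ℝ, ∀ U, |F U| ≤ C) (hF0 : DependsOn F {e : Edge d L | e.1 0 = 0 ∧ e.2 ≠ 0})
    (s : ZMod L) :
    (wilsonExpectation ρ β F) ^ 2 ≤
      wilsonExpectation ρ β fun U =>
        F U * F (torusConfigShift (-(Pi.single (0 : Fin d) s : Site d L)) U) := by
  obtain ⟨t, ht1, ht2, hts⟩ := exists_oddSlice hL hL3 s
  have h := wilsonExpectation_sq_le_timeZero_twoPoint_slice ρ hL hL3 hρ hβ hFm hFb hF0 ht1 ht2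
  rcases hts with hts | hts
  · rw [hts] at h
    exact h
  · rw [hts] at h
    rw [wilsonExpectation_twoPoint_neg]
    exact h

/-- Connected form: the connected time autocorrelation `⟨F · F(· + s e₀)⟩ − ⟨F⟩⟨F(· + s e₀)⟩`
of a time-zero spatial observable is non-negative at every separation. [folklore] -/
theorem wilsonExpectation_timeZero_connected_nonneg (hL : Odd L) (hL3 : 3 ≤ L)
    (hρ : Continuous ρ) {β : ℝ} (hβ : 0 ≤ β) {F : GaugeConfig d L G → ℝ} (hFm : Measurable F)
    (hFb : ∃ C : ℝ, ∀ U, |F U| ≤ C) (hF0 : DependsOn F {e : Edge d L | e.1 0 = 0 ∧ e.2 ≠ 0})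
    (s : ZMod L) :
    0 ≤ wilsonExpectation ρ β
          (fun U => F U * F (torusConfigShift (-(Pi.single (0 : Fin d) s : Site d L)) U)) -
      wilsonExpectation ρ β F *
        wilsonExpectation ρ β
          (fun U => F (torusConfigShift (-(Pi.single (0 : Fin d) s : Site d L)) U)) := by
  have h := wilsonExpectation_sq_le_timeZero_twoPoint ρ hL hL3 hρ hβ hFm hFb hF0 s
  have h1 : wilsonExpectation ρ β
      (fun U => F (torusConfigShift (-(Pi.single (0 : Fin d) s : Site d L)) U)) =
      wilsonExpectation ρ β F :=
    wilsonExpectation_comp_torusConfigShift ρ β (-(Pi.single (0 : Fin d) s : Site d L)) F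
  rw [h1]
  nlinarith [h]

end TimeZero

end Summit.QuantumFields.YangMills.Theorems.SoloBlind

end
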